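import Summits.QuantumFields.YangMills.Theses.BalabanUVNodes
import Literature.MathematicalPhysics.QuantumFieldTheory.Balaban1983to89.B14Cor3
import Summits.QuantumFields.YangMills.Theorems.BalabanUVNodesN13WindowAtRecord13SepCoPH

/-!
# Crux K1⁷ — WHAT ITS TWO CONJUNCTS JOINTLY BUY (kernel form of the vet's «vacuity species barred»): under [III]'s END STATEMENT (B) the `K ≥ 1` window is
# EQUIVALENT to «inside EVERY coupling window `]0, γ]` some genuine renormalisation run (at least one step) carries §2's description and the UV bounds (2.50) at
# EVERY level» — for every `B16.Construction`, at NODE 00's Stage-13 datum, and for the route decl `StabilityBAtRecordR13SepCoPH` BY NAME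

Cell `pub-ymgap`, YM-PLAN Track A (HUMAN RULING D-0062 ∕ D-0149, director-ym №197), WIDTH SEAT `pub-ymgap-dag-n13-w4` (g2) on NODE n13 [Balaban1989LargeFieldII]; helper
(`--supports`) for crux K1⁷ `StabilityBAtRecordR13SepCoPH` = stmt-QuantumFields-20542 (plan g73 rev 24∕25; skeleton v5 38c62055d1ac34a4).  SUCCESSOR STOREY of W-SEAT-START-LIST
§1 n13 ITEM 4 = n24 ITEM 2 (the `Window` clause; one declarer: this seat — g0's `…K1WindowFirstStep` ∕ `…N13WindowAtRecord13SepCoPH`, g2's `…K1WindowExactCriterion`).  COUNT-NEUTRAL.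

WHY THIS FILE.  K1⁷'s conclusion at its chosen `(θ, h)` is `B16.EndStatementBPrinted D.C ∧ Window D` with `D := Node00.datumOfRecord₁₃SepCoPH F 2 θ h`,
`EndStatementBPrinted C := Thm1Printed C ∧ Cor3_250 C` ([Balaban1989LargeFieldII] Thm 1 p. 355 ∧ [Balaban1988Convergent] Cor. 3 (2.50) p. 264, each of the shape
`∃ γ > 0, ∀ P, (C P).flow.InInterval γ P.K → …` — CONDITIONAL on the run staying in `]0, γ]`) and `Window D := ∃ γ₁ > 0, ∀ γ ∈ ]0, γ₁], ∃ P, 1 ≤ P.K ∧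
(D.C P).flow.InInterval γ P.K` ([Balaban1988Convergent] (0.4) p. 235: NON-VACUITY only).  The vet of record (refuter-ym-vet-20542, VET-20542.md) says informally «vacuity
species barred: `1 ≤ P.K` + window ⇒ Thm 1 ∕ Cor 3 bite at levels 1…K».  THIS FILE is that sentence in the kernel, as an EQUIVALENCE: for EVERY `C : B16.Construction`
with (B), the window holds IFF

  `∃ em ep : ℝ → ℝ, ∀ γ > 0, ∃ P, 1 ≤ P.K ∧ (C P).flow.InInterval γ P.K ∧ (∀ k ≤ P.K, (C P).Sect2Form k) ∧ ∀ k ≤ P.K, ∀ V, B16.UVIneq (C P) k V (em (g_k)) (ep (g_k))`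

— «inside EVERY coupling window some run with at least one renormalisation step carries [III] §2's description ((2.18) + Thm 2) at EVERY level `k ≤ K` and the two-sided
ultraviolet bounds (2.50) at every level and configuration, with level-independent dependence functions `e_±(g_k)`» (⟹: shrink `γ` below Thm 1's and Cor. 3's constants and
take the window's run there — the `∃ γ₁` is spurious, `InInterval` being monotone in `γ`; ⟸: forget).  Hence K1⁷ ⟺ K1⁷ with its last conjunct REPLACED by this «bite»
clause (`stabilityBAtRecordR13SepCoPH_iff_bites`), and the route decl BY NAME yields, for every family `F` admitted by K0⁷'s hypothesis, an admissible unity tuple whose Stage-13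
datum of record bites in every window (`bites_of_stabilityBAtRecordR13SepCoPH`).  What K1⁷ does NOT buy is recorded too: runs of EVERY length in every window (that is K2⁷'s
`DagBinding.EndpointExistence`, which conversely implies the window — `…N27SpineGivenEndpointR11Vacuity.window_of_endpointExistence`), and the UNIFORM-constant reading (0.1)
`B16.UVBound01` (refuted under small bare couplings by `B16B10Shape.not_uvBound01_of_smallCouplings` — and the window FORCES small bare couplings: `smallBareCouplings_of_window`).

WHAT THIS FILE PROVES (theorems only, 0 `def`, 0 `sorry`).
* §1 every `C : B16.Construction` (monotonicity of `InInterval` in `γ` = `B14Cor3.inInterval_of_le`, cited): `window_iff_forall_pos'` (the `∃ γ₁` is spurious) · ★ `smallBareCouplings_of_window` (∀ δ > 0 some run with `K ≥ 1`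
  in `]0, δ]` has bare coupling `g_0 ≤ δ`) · ★★ `bites_of_endStatementBPrinted_of_window` · `window_of_bites` · ★★ `window_iff_bites_of_endStatementBPrinted` · the one-sided
  halves `sect2Form_bites_of_thm1Printed_of_window` ∕ `uvIneq_bites_of_cor3_of_window`.
* §2 at `Node00.datumOfRecord₁₃SepCoPH F N θ h` (general `N`, every `h`; no hypothesis on `θ`): `bites_datumOfRecord₁₃SepCoPH_of_endStatementBPrinted_of_window` ·
  `window_datumOfRecord₁₃SepCoPH_iff_bites`.
* §3 THE ROUTE DECL BY NAME (`N = 2`): ★★ `stabilityBAtRecordR13SepCoPH_iff_bites` (K1⁷ ⟺ K1⁷-with-bite-conjunct) · ★★ `bites_of_stabilityBAtRecordR13SepCoPH` (the cash value of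
  K1⁷ for every `F` admitted by K0⁷'s hypothesis).

HONEST SCOPE (A6, №189).  Quantifier bookkeeping over the printed readings (`B16.Thm1Printed`, `B16.Cor3_250`, `Setup.Flow.InInterval`); (B), the window and K1⁷ itself enter
ONLY as hypotheses ∕ sides of an `iff` — nothing of Bałaban's analysis is asserted, used or discharged; K1⁷ is NOT proved (it is the antecedent of §3's second theorem); N13 NOT
discharged; K1⁷ ∕ K2⁷ NOT closed; no stub closed; counts unmoved (typed 28∕28 · discharged 5∕27 · A 5∕28).  One finite four-torus programme at fixed `ε = L^{−K}`, Bałaban AS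
PRINTED; the YM mass gap (Clay) is NOT proved by any of this — R4 closes the conditional finite-𝕋⁴ rung `BalabanLadder.UV` only; nothing continuum ∕ ℝ⁴ ∕ OS.  No `def`, no
`instance`, no `notation`, no `axiom`.
References: [III] = [Balaban1988Convergent] CMP **119** (1988): (0.4) p. 235, Thm 1 p. 262, Thm 2 (2.43)–(2.49) pp. 263–264, Cor. 3 (2.50) p. 264; [B16] = [Balaban1989LargeFieldII]
CMP **122** (1989): Thm 1 + (0.1) pp. 355–356; [I] = [Balaban1987RG1] CMP **109** (1987): Thm 2 p. 259, (0.31) p. 259.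
-/

noncomputable section

open scoped Matrix.Norms.L2Operator

namespace Summit.QuantumFields.YangMills.Theorems.BalabanUVNodesK1WindowBite

open Literature.MathematicalPhysics.QuantumFieldTheory.Balaban1983to89
open Literature.MathematicalPhysics.QuantumFieldTheory.Balaban1983to89.T4Continuum (T4Family FiniteEpsData)
open Literature.MathematicalPhysics.QuantumFieldTheory.Balaban1983to89.Node00
open Literature.MathematicalPhysics.QuantumFieldTheory.Balaban1983to89.B14Cor3 (inInterval_of_le)

/-! ## §1. Every `B16.Construction`: under (B) the `K ≥ 1` window is equivalent to the «bite» clause -/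

section Construction

/-- **The `∃ γ₁` of the window is spurious** (any `C : B16.Construction`): `(∃ γ₁ > 0, ∀ γ ∈ ]0, γ₁], ∃ P, 1 ≤ P.K ∧ (C P).flow.InInterval γ P.K) ↔
(∀ γ > 0, ∃ P, 1 ≤ P.K ∧ (C P).flow.InInterval γ P.K)` (for `γ > γ₁` the witness at `γ₁` serves). [cite: Balaban1988Convergent, (0.4) p.235 and Thm 1 p.262 (elementary)] -/
theorem window_iff_forall_pos' (C : B16.Construction) :
    (∃ γ₁ : ℝ, 0 < γ₁ ∧ ∀ γ : ℝ, 0 < γ → γ ≤ γ₁ → ∃ P : B12.RunParams, 1 ≤ P.K ∧ (C P).flow.InInterval γ P.K) ↔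
      ∀ γ : ℝ, 0 < γ → ∃ P : B12.RunParams, 1 ≤ P.K ∧ (C P).flow.InInterval γ P.K := by
  constructor
  · rintro ⟨γ₁, hγ₁, h⟩ γ hγ
    rcases le_or_gt γ γ₁ with hle | hlt
    · exact h γ hγ hle
    · obtain ⟨P, hK, hI⟩ := h γ₁ hγ₁ le_rfl
      exact ⟨P, hK, inInterval_of_le hI hlt.le⟩
  · exact fun h => ⟨1, one_pos, fun γ hγ _ => h γ hγ⟩

/-- ★ **THE WINDOW FORCES ARBITRARILY SMALL BARE COUPLINGS ON RUNS WITH A STEP**: for every `δ > 0` some run `P` with `1 ≤ P.K` stays in `]0, δ]`, in particular its bare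
coupling satisfies `0 < (C P).flow.g 0 ≤ δ` — the regime in which the UNIFORM-constant reading (0.1) `B16.UVBound01` is refuted by `B16B10Shape.not_uvBound01_of_smallCouplings`
(given the step-0 logarithm), which is why K1⁷ books [III]'s `Cor3_250` (constants depending on `g_k`). [cite: Balaban1987RG1, (0.31) p.259; Balaban1988Convergent, Cor. 3 (2.50) p.264 (bookkeeping)] -/
theorem smallBareCouplings_of_window (C : B16.Construction)
    (hwin : ∃ γ₁ : ℝ, 0 < γ₁ ∧ ∀ γ : ℝ, 0 < γ → γ ≤ γ₁ → ∃ P : B12.RunParams, 1 ≤ P.K ∧ (C P).flow.InInterval γ P.K) :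
    ∀ δ : ℝ, 0 < δ → ∃ P : B12.RunParams, 1 ≤ P.K ∧ (C P).flow.InInterval δ P.K ∧ 0 < (C P).flow.g 0 ∧ (C P).flow.g 0 ≤ δ := by
  intro δ hδ
  obtain ⟨P, hK, hI⟩ := (window_iff_forall_pos' C).mp hwin δ hδ
  exact ⟨P, hK, hI, (hI 0 (Nat.zero_le _)).1, (hI 0 (Nat.zero_le _)).2⟩

/-- **Thm 1's half of the bite**: `B16.Thm1Printed C` + the window ⟹ in every coupling window some run with a step carries §2's description at every level.
[cite: Balaban1989LargeFieldII, Thm 1 p.355; Balaban1988Convergent, (0.4) p.235 (bookkeeping)] -/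
theorem sect2Form_bites_of_thm1Printed_of_window (C : B16.Construction) (hT : B16.Thm1Printed C)
    (hwin : ∃ γ₁ : ℝ, 0 < γ₁ ∧ ∀ γ : ℝ, 0 < γ → γ ≤ γ₁ → ∃ P : B12.RunParams, 1 ≤ P.K ∧ (C P).flow.InInterval γ P.K) :
    ∀ γ : ℝ, 0 < γ → ∃ P : B12.RunParams, 1 ≤ P.K ∧ (C P).flow.InInterval γ P.K ∧ ∀ k, k ≤ P.K → (C P).Sect2Form k := by
  obtain ⟨γT, hγT, hT⟩ := hT
  intro γ hγ
  obtain ⟨P, hK, hI⟩ := (window_iff_forall_pos' C).mp hwin (min γ γT) (lt_min hγ hγT)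
  exact ⟨P, hK, inInterval_of_le hI (min_le_left _ _), hT P (inInterval_of_le hI (min_le_right _ _))⟩

/-- **Cor. 3's half of the bite**: `B16.Cor3_250 C` + the window ⟹ level-independent dependence functions `e_±` such that in every coupling window some run with a step carries
the two-sided UV bounds (2.50) at every level and configuration. [cite: Balaban1988Convergent, Cor. 3 (2.50) p.264 and (0.4) p.235 (bookkeeping)] -/
theorem uvIneq_bites_of_cor3_of_window (C : B16.Construction) (hC : B16.Cor3_250 C)
    (hwin : ∃ γ₁ : ℝ, 0 < γ₁ ∧ ∀ γ : ℝ, 0 < γ → γ ≤ γ₁ → ∃ P : B12.RunParams, 1 ≤ P.K ∧ (C P).flow.InInterval γ P.K) :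
    ∃ em ep : ℝ → ℝ, ∀ γ : ℝ, 0 < γ → ∃ P : B12.RunParams, 1 ≤ P.K ∧ (C P).flow.InInterval γ P.K ∧
      ∀ k, k ≤ P.K → ∀ V : (C P).Cfg k, B16.UVIneq (C P) k V (em ((C P).flow.g k)) (ep ((C P).flow.g k)) := by
  obtain ⟨γC, hγC, em, ep, hC⟩ := hC
  refine ⟨em, ep, fun γ hγ => ?_⟩
  obtain ⟨P, hK, hI⟩ := (window_iff_forall_pos' C).mp hwin (min γ γC) (lt_min hγ hγC)
  exact ⟨P, hK, inInterval_of_le hI (min_le_left _ _), hC P (inInterval_of_le hI (min_le_right _ _))⟩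

/-- ★★ **THE BITE OF (B) ∧ WINDOW.**  For every `C : B16.Construction`: [III]'s end statement (B) as printed (`B16.EndStatementBPrinted C` = Thm 1 ∧ Cor. 3 (2.50), each
CONDITIONAL on `InInterval γ`) together with the `K ≥ 1` window gives level-independent `e_± : ℝ → ℝ` such that for EVERY `γ > 0` some run `P` with `1 ≤ P.K` stays in `]0, γ]`
AND carries §2's description `(C P).Sect2Form k` at every `k ≤ P.K` AND the UV bounds `B16.UVIneq (C P) k V (e₋ (g_k)) (e₊ (g_k))` at every `k ≤ P.K` and every `V` (shrink `γ`
below Thm 1's and Cor. 3's constants; take the window's run there). [cite: Balaban1989LargeFieldII, Thm 1 + (0.1) pp.355–356; Balaban1988Convergent, Cor. 3 (2.50) p.264 and (0.4) p.235 (bookkeeping)] -/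
theorem bites_of_endStatementBPrinted_of_window (C : B16.Construction) (hB : B16.EndStatementBPrinted C)
    (hwin : ∃ γ₁ : ℝ, 0 < γ₁ ∧ ∀ γ : ℝ, 0 < γ → γ ≤ γ₁ → ∃ P : B12.RunParams, 1 ≤ P.K ∧ (C P).flow.InInterval γ P.K) :
    ∃ em ep : ℝ → ℝ, ∀ γ : ℝ, 0 < γ → ∃ P : B12.RunParams, 1 ≤ P.K ∧ (C P).flow.InInterval γ P.K ∧
      (∀ k, k ≤ P.K → (C P).Sect2Form k) ∧
        ∀ k, k ≤ P.K → ∀ V : (C P).Cfg k, B16.UVIneq (C P) k V (em ((C P).flow.g k)) (ep ((C P).flow.g k)) := by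
  obtain ⟨⟨γT, hγT, hT⟩, ⟨γC, hγC, em, ep, hC⟩⟩ := hB
  refine ⟨em, ep, fun γ hγ => ?_⟩
  obtain ⟨P, hK, hI⟩ := (window_iff_forall_pos' C).mp hwin (min γ (min γT γC)) (lt_min hγ (lt_min hγT hγC))
  exact ⟨P, hK, inInterval_of_le hI (min_le_left _ _),
    hT P (inInterval_of_le hI ((min_le_right _ _).trans (min_le_left _ _))),
    hC P (inInterval_of_le hI ((min_le_right _ _).trans (min_le_right _ _)))⟩

/-- **Forgetting the bite gives back the window** (no hypothesis). [cite: Balaban1988Convergent, (0.4) p.235 (elementary)] -/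
theorem window_of_bites (C : B16.Construction)
    (h : ∃ em ep : ℝ → ℝ, ∀ γ : ℝ, 0 < γ → ∃ P : B12.RunParams, 1 ≤ P.K ∧ (C P).flow.InInterval γ P.K ∧
      (∀ k, k ≤ P.K → (C P).Sect2Form k) ∧
        ∀ k, k ≤ P.K → ∀ V : (C P).Cfg k, B16.UVIneq (C P) k V (em ((C P).flow.g k)) (ep ((C P).flow.g k))) :
    ∃ γ₁ : ℝ, 0 < γ₁ ∧ ∀ γ : ℝ, 0 < γ → γ ≤ γ₁ → ∃ P : B12.RunParams, 1 ≤ P.K ∧ (C P).flow.InInterval γ P.K := by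
  obtain ⟨_, _, hb⟩ := h
  refine (window_iff_forall_pos' C).mpr fun γ hγ => ?_
  obtain ⟨P, hK, hI, -, -⟩ := hb γ hγ
  exact ⟨P, hK, hI⟩

/-- ★★ **UNDER (B), THE `K ≥ 1` WINDOW IS EQUIVALENT TO THE BITE CLAUSE** (every `C : B16.Construction`): given `B16.EndStatementBPrinted C`, the window
`∃ γ₁ > 0, ∀ γ ∈ ]0, γ₁], ∃ P, 1 ≤ P.K ∧ InInterval γ P.K` ↔ `∃ e₋ e₊, ∀ γ > 0, ∃ P, 1 ≤ P.K ∧ InInterval γ P.K ∧ (∀ k ≤ P.K, Sect2Form k) ∧ (∀ k ≤ P.K, ∀ V, UVIneq … (e₋ g_k) (e₊ g_k))`.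
So «(B) ∧ window» and «(B) ∧ bite» are the same statement. [cite: Balaban1989LargeFieldII, Thm 1 + (0.1) pp.355–356; Balaban1988Convergent, Cor. 3 (2.50) p.264 and (0.4) p.235 (bookkeeping)] -/
theorem window_iff_bites_of_endStatementBPrinted (C : B16.Construction) (hB : B16.EndStatementBPrinted C) :
    (∃ γ₁ : ℝ, 0 < γ₁ ∧ ∀ γ : ℝ, 0 < γ → γ ≤ γ₁ → ∃ P : B12.RunParams, 1 ≤ P.K ∧ (C P).flow.InInterval γ P.K) ↔
      ∃ em ep : ℝ → ℝ, ∀ γ : ℝ, 0 < γ → ∃ P : B12.RunParams, 1 ≤ P.K ∧ (C P).flow.InInterval γ P.K ∧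
        (∀ k, k ≤ P.K → (C P).Sect2Form k) ∧
          ∀ k, k ≤ P.K → ∀ V : (C P).Cfg k, B16.UVIneq (C P) k V (em ((C P).flow.g k)) (ep ((C P).flow.g k)) :=
  ⟨bites_of_endStatementBPrinted_of_window C hB, window_of_bites C⟩

end Construction

/-! ## §2. At NODE 00's Stage-13 datum `datumOfRecord₁₃SepCoPH F N θ h` -/

section Record

variable {F : T4Family} {N : ℕ} [NeZero N]

/-- **THE BITE AT THE STAGE-13 DATUM** (general `N`, every proviso witness `h`; no hypothesis on `θ`): (B) at `(datumOfRecord₁₃SepCoPH F N θ h).C` + the window there ⟹ the bite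
clause there. [cite: Balaban1989LargeFieldII, Thm 1 + (0.1) pp.355–356; Balaban1988Convergent, Cor. 3 (2.50) p.264 and (0.4) p.235 (bookkeeping)] -/
theorem bites_datumOfRecord₁₃SepCoPH_of_endStatementBPrinted_of_window (θ : Stage13HParams F N) (h : θ.Provisos₁₃SepCoPH F N)
    (hB : B16.EndStatementBPrinted (datumOfRecord₁₃SepCoPH F N θ h).C)
    (hwin : ∃ γ₁ : ℝ, 0 < γ₁ ∧ ∀ γ : ℝ, 0 < γ → γ ≤ γ₁ →
      ∃ P : B12.RunParams, 1 ≤ P.K ∧ ((datumOfRecord₁₃SepCoPH F N θ h).C P).flow.InInterval γ P.K) :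
    ∃ em ep : ℝ → ℝ, ∀ γ : ℝ, 0 < γ → ∃ P : B12.RunParams, 1 ≤ P.K ∧ ((datumOfRecord₁₃SepCoPH F N θ h).C P).flow.InInterval γ P.K ∧
      (∀ k, k ≤ P.K → ((datumOfRecord₁₃SepCoPH F N θ h).C P).Sect2Form k) ∧
        ∀ k, k ≤ P.K → ∀ V : ((datumOfRecord₁₃SepCoPH F N θ h).C P).Cfg k,
          B16.UVIneq ((datumOfRecord₁₃SepCoPH F N θ h).C P) k V
            (em (((datumOfRecord₁₃SepCoPH F N θ h).C P).flow.g k)) (ep (((datumOfRecord₁₃SepCoPH F N θ h).C P).flow.g k)) :=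
  bites_of_endStatementBPrinted_of_window _ hB hwin

/-- **AT THE STAGE-13 DATUM, UNDER (B), K1⁷'s LAST CONJUNCT ↔ THE BITE CLAUSE.** [cite: Balaban1989LargeFieldII, Thm 1 + (0.1) pp.355–356; Balaban1988Convergent, Cor. 3 (2.50) p.264 and (0.4) p.235 (bookkeeping)] -/
theorem window_datumOfRecord₁₃SepCoPH_iff_bites (θ : Stage13HParams F N) (h : θ.Provisos₁₃SepCoPH F N)
    (hB : B16.EndStatementBPrinted (datumOfRecord₁₃SepCoPH F N θ h).C) :
    (∃ γ₁ : ℝ, 0 < γ₁ ∧ ∀ γ : ℝ, 0 < γ → γ ≤ γ₁ →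
        ∃ P : B12.RunParams, 1 ≤ P.K ∧ ((datumOfRecord₁₃SepCoPH F N θ h).C P).flow.InInterval γ P.K) ↔
      ∃ em ep : ℝ → ℝ, ∀ γ : ℝ, 0 < γ → ∃ P : B12.RunParams, 1 ≤ P.K ∧ ((datumOfRecord₁₃SepCoPH F N θ h).C P).flow.InInterval γ P.K ∧
        (∀ k, k ≤ P.K → ((datumOfRecord₁₃SepCoPH F N θ h).C P).Sect2Form k) ∧
          ∀ k, k ≤ P.K → ∀ V : ((datumOfRecord₁₃SepCoPH F N θ h).C P).Cfg k,
            B16.UVIneq ((datumOfRecord₁₃SepCoPH F N θ h).C P) k V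
              (em (((datumOfRecord₁₃SepCoPH F N θ h).C P).flow.g k)) (ep (((datumOfRecord₁₃SepCoPH F N θ h).C P).flow.g k)) :=
  window_iff_bites_of_endStatementBPrinted _ hB

end Record

/-! ## §3. The route decl BY NAME (`N = 2`): K1⁷ ⟺ K1⁷-with-bite-conjunct; the cash value of K1⁷ -/

section RouteDecl

/-- ★★ **K1⁷ IS EQUIVALENT TO K1⁷ WITH ITS LAST CONJUNCT REPLACED BY THE BITE CLAUSE**: `StabilityBAtRecordR13SepCoPH ↔ (∀ F, K0⁷-hypothesis F → ∃ θ h, unity ∧ admissible ∧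
(B) at the datum ∧ ∃ e₋ e₊, ∀ γ > 0, ∃ P, 1 ≤ P.K ∧ InInterval γ P.K ∧ (∀ k ≤ P.K, Sect2Form k) ∧ (∀ k ≤ P.K, ∀ V, UVIneq … (e₋ g_k) (e₊ g_k)))` — the route decl's text with
the window spelled as what it buys under its own (B)-conjunct. [cite: Balaban1989LargeFieldII, Thm 1 + (0.1) pp.355–356; Balaban1988Convergent, Cor. 3 (2.50) p.264 and (0.4) p.235 (bookkeeping)] -/
theorem stabilityBAtRecordR13SepCoPH_iff_bites :
    Summit.QuantumFields.YangMills.Theses.BalabanUVNodes.StabilityBAtRecordR13SepCoPH ↔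
      ∀ F : T4Family, (∃ θ : Stage13HParams F 2, θ.Provisos₁₃SepCoPH F 2 ∧ (θ.ZhUnity F 2 ∧ θ.SlotsNondegenerate₁₃ F 2) ∧ θ.Admissible F 2) →
        ∃ (θ : Stage13HParams F 2) (h : θ.Provisos₁₃SepCoPH F 2), (θ.ZhUnity F 2 ∧ θ.SlotsNondegenerate₁₃ F 2) ∧ θ.Admissible F 2 ∧
          B16.EndStatementBPrinted (datumOfRecord₁₃SepCoPH F 2 θ h).C ∧
            ∃ em ep : ℝ → ℝ, ∀ γ : ℝ, 0 < γ → ∃ P : B12.RunParams, 1 ≤ P.K ∧ ((datumOfRecord₁₃SepCoPH F 2 θ h).C P).flow.InInterval γ P.K ∧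
              (∀ k, k ≤ P.K → ((datumOfRecord₁₃SepCoPH F 2 θ h).C P).Sect2Form k) ∧
                ∀ k, k ≤ P.K → ∀ V : ((datumOfRecord₁₃SepCoPH F 2 θ h).C P).Cfg k,
                  B16.UVIneq ((datumOfRecord₁₃SepCoPH F 2 θ h).C P) k V
                    (em (((datumOfRecord₁₃SepCoPH F 2 θ h).C P).flow.g k)) (ep (((datumOfRecord₁₃SepCoPH F 2 θ h).C P).flow.g k)) := by
  constructor
  · intro hK1 F hinh
    obtain ⟨θ, h, hU, hθ, hB, hwin⟩ := hK1 F hinh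
    exact ⟨θ, h, hU, hθ, hB, (window_datumOfRecord₁₃SepCoPH_iff_bites θ h hB).mp hwin⟩
  · intro hK1 F hinh
    obtain ⟨θ, h, hU, hθ, hB, hbite⟩ := hK1 F hinh
    exact ⟨θ, h, hU, hθ, hB, (window_datumOfRecord₁₃SepCoPH_iff_bites θ h hB).mpr hbite⟩

/-- ★★ **THE CASH VALUE OF K1⁷** (the route decl BY NAME as hypothesis — K1⁷ is NOT proved here): for every four-torus family `F` admitted by K0⁷'s hypothesis (some Stage-13
tuple with provisos, unity ∧ non-degeneracy, admissibility), K1⁷ yields an admissible unity tuple `θ` with proviso witness `h` whose Stage-13 datum of record has (B) AND BITES IN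
EVERY COUPLING WINDOW: level-independent `e_±` and, for every `γ > 0`, a run `P` with `1 ≤ P.K` inside `]0, γ]` carrying §2's description at every `k ≤ P.K` and the UV
bounds (2.50) at every `k ≤ P.K` and every configuration — in particular at the genuine renormalisation level `k = 1`.  NOT bought: runs of every length (K2⁷'s
`EndpointExistence`) and the uniform-constant reading `B16.UVBound01`. [cite: Balaban1989LargeFieldII, Thm 1 + (0.1) pp.355–356; Balaban1988Convergent, Cor. 3 (2.50) p.264 and (0.4) p.235 (bookkeeping)] -/
theorem bites_of_stabilityBAtRecordR13SepCoPH (hK1 : Summit.QuantumFields.YangMills.Theses.BalabanUVNodes.StabilityBAtRecordR13SepCoPH) (F : T4Family)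
    (hinh : ∃ θ : Stage13HParams F 2, θ.Provisos₁₃SepCoPH F 2 ∧ (θ.ZhUnity F 2 ∧ θ.SlotsNondegenerate₁₃ F 2) ∧ θ.Admissible F 2) :
    ∃ (θ : Stage13HParams F 2) (h : θ.Provisos₁₃SepCoPH F 2), (θ.ZhUnity F 2 ∧ θ.SlotsNondegenerate₁₃ F 2) ∧ θ.Admissible F 2 ∧
      B16.EndStatementBPrinted (datumOfRecord₁₃SepCoPH F 2 θ h).C ∧
        ∃ em ep : ℝ → ℝ, ∀ γ : ℝ, 0 < γ → ∃ P : B12.RunParams, 1 ≤ P.K ∧ ((datumOfRecord₁₃SepCoPH F 2 θ h).C P).flow.InInterval γ P.K ∧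
          (∀ k, k ≤ P.K → ((datumOfRecord₁₃SepCoPH F 2 θ h).C P).Sect2Form k) ∧
            ∀ k, k ≤ P.K → ∀ V : ((datumOfRecord₁₃SepCoPH F 2 θ h).C P).Cfg k,
              B16.UVIneq ((datumOfRecord₁₃SepCoPH F 2 θ h).C P) k V
                (em (((datumOfRecord₁₃SepCoPH F 2 θ h).C P).flow.g k)) (ep (((datumOfRecord₁₃SepCoPH F 2 θ h).C P).flow.g k)) :=
  stabilityBAtRecordR13SepCoPH_iff_bites.mp hK1 F hinh

end RouteDecl

end Summit.QuantumFields.YangMills.Theorems.BalabanUVNodesK1WindowBite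

end
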